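import Summits.Ventures.HSemireg.WedgeHankelKernelColumnSpace
import Summits.Ventures.HSemireg.WedgeHankelOuterFamilyImageSum

/-!
# Venture HSemireg — THE KERNEL DETERMINES THE COLUMN SPACE: M14's antitone map `col H_k(q) ↦ Kr(univ, w_N q, k)` is an ORDER ANTI-EMBEDDING — for `k ≤ N` and any two classes
# **`Kr(univ, w_N q′, k) ⊆ Kr(univ, w_N q, k) ↔ col H_k(q) ⊆ col H_k(q′)`**, hence `Kr(w_N q, k) = Kr(w_N q′, k) ↔ col H_k(q) = col H_k(q′)`; the same for finite families
# (**`Hom ⊓ ⋂_{c′} Kr(w_N q′_{c′}, k) ⊆ Hom ⊓ ⋂_c Kr(w_N q_c, k) ↔ Σ_c col H_k(q_c) ⊆ Σ_{c′} col H_k(q′_{c′})`**), for the mixed question «does every form killing all `w_N(q_c)` kill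
# `w_N(q₀)`?» (**`↔ col H_k(q₀) ⊆ Σ_c col H_k(q_c)`**), and for the images in the mirror degree — every field

HONEST FRAMING. Part of the Lean index of the computation cell `pub-hsemireg` (seat p10 gen 25, Sunday typer «UNIFORM-IN-n»).
Finite-dimensional EXTERIOR ALGEBRA over a field + ranks / column spaces of Hankel matrices ONLY: no variety, no cohomology theory, no sheaf, no Ext group, no semiregularity map;
nothing here says that HC / HC_CM / HC_AV holds; no Literature fact is declared or used.  Custodian versions as in `WedgeHankelSiegelIdeal` (1/3) and `WedgeKernelDuality` (E1); the
dictionary (`col H_k(q) ⊆ K^{k+1}` the column space of the catalecticant; `J_k(q) = Hom(univ,k) ⊓ ⋂_c Kr(univ, w_N q_c, k)` the joint kernel of a family) is QUOTED, never asserted.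

WHAT IS IN THE TREE.  M14 (`WedgeHankelKernelColumnSpace`): `Kr_w_anti_of_range_hankel1_le` (`col ⊆ col′ ⇒ Kr′ ⊆ Kr`), `Kr_w_eq_of_range_hankel1_eq`, `rank_hank_eq_finrank_iSup_range`; J1
`finrank_iInf_Kr_w_top_add` (the joint kernel law); M11 `iSup_V_w_eq_Ann` (the joint image is the annihilator of the joint kernel); E1 `Ann_anti`, `Ann_Ann` (double annihilator).
THIS FILE adds the CONVERSES (namespace `Summit.Ventures.HSemireg.Wedge.HankelOuter` continued; imports M14, M11):
* §440 **`Hom_iInf_Kr_w_le_iff_iSup_range_le`** (`k ≤ N`, two finite families: `J(q′) ≤ J(q) ↔ Σ col(q) ≤ Σ col(q′)`; proof: the joint kernel law for the UNION family `q ⊔ q′`, whose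
  joint kernel is `J(q) ⊓ J(q′)` and whose column sum is `Σ col(q) ⊔ Σ col(q′)`, read in both directions), **`Hom_iInf_Kr_w_eq_iff_iSup_range_eq`** (THE JOINT KERNEL DETERMINES THE
  COLUMN SUM), **`Hom_iInf_Kr_w_le_Kr_w_iff_range_le_iSup`** (every form killing all `w_N(q_c)` kills `w_N(q₀)` `↔ col H_k(q₀) ⊆ Σ_c col H_k(q_c)`).
* §441 ONE CLASS EACH: **`Kr_w_le_Kr_w_iff_range_le`** (`Kr(w_N q′, k) ⊆ Kr(w_N q, k) ↔ col H_k(q) ⊆ col H_k(q′)`), **`Kr_w_eq_Kr_w_iff_range_eq`** (THE KERNEL DETERMINES THE COLUMN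
  SPACE), `Kr_w_lt_Kr_w_iff_range_lt`.
* §442 IMAGES (`k + k′ = N`): `iSup_V_w_le_iff_iSup_range_le`, `iSup_V_w_eq_iff_iSup_range_eq`, `V_w_le_V_w_iff_range_le`, **`V_w_eq_V_w_iff_range_eq`** (the image in the mirror
  degree determines the column space too; E1's double annihilator).
READING: in degree `k ≤ N` the invariant of a class (or of a finite family of classes) carried by its kernel — equivalently by its image in degree `N − k` — is EXACTLY the subspace
`col H_k(q) ⊆ K^{k+1}` (resp. `Σ_c col H_k(q_c)`): no finer and no coarser.  The atlas's Torelli statements (G7: the kernel of a node class determines node and order; H4: top degree)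
are the injectivity of `node ↦ osculating flat` composed with this.  NOT typed here: which subspaces of `K^{k+1}` are column spaces of catalecticants (all of them are column SUMS of
node classes).  Nothing Ext-side.  New names only.
-/

open Module

namespace Summit.Ventures.HSemireg.Wedge.HankelOuter

open Summit.Ventures.HSemireg.Wedge Summit.Ventures.HSemireg.Wedge.Kunneth Summit.Ventures.HSemireg.Wedge.Hankel
  Summit.Ventures.HSemireg.Wedge.BasisFree Summit.Ventures.HSemireg.Wedge.HankelSiegel Summit.Ventures.HSemireg.Wedge.HankelSiegelIdeal
  Summit.Ventures.HSemireg.Wedge.KunnethKernel Summit.Ventures.HSemireg.Wedge.HankelFrameChange Summit.Ventures.HSemireg.Wedge.KernelDuality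

variable (K : Type*) [Field K] {N : ℕ} {ι ι' : Type} [Fintype ι] [DecidableEq ι] [Fintype ι'] [DecidableEq ι']

/-! ## §440. The joint kernel of a family determines the sum of its column spaces -/

/-- **THE KERNELS SEE EXACTLY THE COLUMN SUM: for `k ≤ N` and two finite families of classes of one box,
`Hom(univ,k) ⊓ ⋂_{c′} Kr(univ, w_N q′_{c′}, k) ⊆ Hom(univ,k) ⊓ ⋂_c Kr(univ, w_N q_c, k) ↔ Σ_c col H_k(q_c) ⊆ Σ_{c′} col H_k(q′_{c′})`** (every field). Proof: the joint kernel law (J1)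
for the union family `q ⊔ q′` — joint kernel `J(q) ⊓ J(q′)`, column sum `Σ col(q) ⊔ Σ col(q′)` — against the law for `q′`: `J(q) ⊓ J(q′) = J(q′)` iff the two column sums have the same
dimension iff `Σ col(q) ⊔ Σ col(q′) = Σ col(q′)` (`C(N,k) ≠ 0` for `k ≤ N`). -/
theorem Hom_iInf_Kr_w_le_iff_iSup_range_le {k : ℕ} (hk : k ≤ N) (q : ι → ℕ → K) (q' : ι' → ℕ → K) :
    Hom K (In N) (Finset.univ : Finset (In N)) k ⊓ (⨅ c, Kr K (Finset.univ : Finset (In N)) (w K N N (q' c)) k)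
        ≤ Hom K (In N) (Finset.univ : Finset (In N)) k ⊓ (⨅ c, Kr K (Finset.univ : Finset (In N)) (w K N N (q c)) k)
      ↔ (⨆ c, LinearMap.range (hankel1 K N k (q c)).mulVecLin) ≤ ⨆ c, LinearMap.range (hankel1 K N k (q' c)).mulVecLin := by
  have hJ : Hom K (In N) (Finset.univ : Finset (In N)) k ⊓ (⨅ c, Kr K (Finset.univ : Finset (In N)) (w K N N (Sum.elim q q' c)) k)
      = (Hom K (In N) (Finset.univ : Finset (In N)) k ⊓ ⨅ c, Kr K (Finset.univ : Finset (In N)) (w K N N (q c)) k)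
          ⊓ (Hom K (In N) (Finset.univ : Finset (In N)) k ⊓ ⨅ c, Kr K (Finset.univ : Finset (In N)) (w K N N (q' c)) k) := by
    rw [iInf_sum]
    simp only [Sum.elim_inl, Sum.elim_inr]
    exact inf_inf_distrib_left _ _ _
  have hC : (⨆ c, LinearMap.range (hankel1 K N k (Sum.elim q q' c)).mulVecLin)
      = (⨆ c, LinearMap.range (hankel1 K N k (q c)).mulVecLin) ⊔ (⨆ c, LinearMap.range (hankel1 K N k (q' c)).mulVecLin) := by
    rw [iSup_sum]
    simp only [Sum.elim_inl, Sum.elim_inr]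
  have h1 := finrank_iInf_Kr_w_top_add K (N := N) k (Sum.elim q q')
  have h2 := finrank_iInf_Kr_w_top_add K (N := N) k q'
  rw [rank_hank_eq_finrank_iSup_range, hJ, hC] at h1
  rw [rank_hank_eq_finrank_iSup_range] at h2
  have hpos := Nat.choose_pos hk
  constructor
  · intro h
    rw [inf_eq_right.mpr h] at h1
    have hd : finrank K ↥((⨆ c, LinearMap.range (hankel1 K N k (q c)).mulVecLin) ⊔ ⨆ c, LinearMap.range (hankel1 K N k (q' c)).mulVecLin)
        = finrank K ↥(⨆ c, LinearMap.range (hankel1 K N k (q' c)).mulVecLin) := Nat.eq_of_mul_eq_mul_left hpos (by omega)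
    have hsup := Submodule.eq_of_le_of_finrank_eq
      (le_sup_right : (⨆ c, LinearMap.range (hankel1 K N k (q' c)).mulVecLin)
        ≤ (⨆ c, LinearMap.range (hankel1 K N k (q c)).mulVecLin) ⊔ ⨆ c, LinearMap.range (hankel1 K N k (q' c)).mulVecLin) hd.symm
    exact le_sup_left.trans_eq hsup.symm
  · intro h
    rw [sup_eq_right.mpr h] at h1
    exact inf_eq_right.mp (Submodule.eq_of_le_of_finrank_eq
      (inf_le_right : (Hom K (In N) (Finset.univ : Finset (In N)) k ⊓ ⨅ c, Kr K (Finset.univ : Finset (In N)) (w K N N (q c)) k)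
          ⊓ (Hom K (In N) (Finset.univ : Finset (In N)) k ⊓ ⨅ c, Kr K (Finset.univ : Finset (In N)) (w K N N (q' c)) k)
        ≤ Hom K (In N) (Finset.univ : Finset (In N)) k ⊓ ⨅ c, Kr K (Finset.univ : Finset (In N)) (w K N N (q' c)) k) (by omega))

/-- **THE JOINT KERNEL DETERMINES THE COLUMN SUM: `J(q) = J(q′) ↔ Σ_c col H_k(q_c) = Σ_{c′} col H_k(q′_{c′})`** (`k ≤ N`). -/
theorem Hom_iInf_Kr_w_eq_iff_iSup_range_eq {k : ℕ} (hk : k ≤ N) (q : ι → ℕ → K) (q' : ι' → ℕ → K) :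
    Hom K (In N) (Finset.univ : Finset (In N)) k ⊓ (⨅ c, Kr K (Finset.univ : Finset (In N)) (w K N N (q c)) k)
        = Hom K (In N) (Finset.univ : Finset (In N)) k ⊓ (⨅ c, Kr K (Finset.univ : Finset (In N)) (w K N N (q' c)) k)
      ↔ (⨆ c, LinearMap.range (hankel1 K N k (q c)).mulVecLin) = ⨆ c, LinearMap.range (hankel1 K N k (q' c)).mulVecLin := by
  rw [le_antisymm_iff, le_antisymm_iff, Hom_iInf_Kr_w_le_iff_iSup_range_le K hk q' q, Hom_iInf_Kr_w_le_iff_iSup_range_le K hk q q', and_comm]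

omit [Fintype ι'] [DecidableEq ι'] in
/-- **every degree-`k` form killing all the `w_N(q_c)` kills `w_N(q₀)` IF AND ONLY IF `col H_k(q₀) ⊆ Σ_c col H_k(q_c)`** (`k ≤ N`): linear dependence of kernel conditions is column
containment. -/
theorem Hom_iInf_Kr_w_le_Kr_w_iff_range_le_iSup {k : ℕ} (hk : k ≤ N) (q : ι → ℕ → K) (q₀ : ℕ → K) :
    Hom K (In N) (Finset.univ : Finset (In N)) k ⊓ (⨅ c, Kr K (Finset.univ : Finset (In N)) (w K N N (q c)) k) ≤ Kr K (Finset.univ : Finset (In N)) (w K N N q₀) k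
      ↔ LinearMap.range (hankel1 K N k q₀).mulVecLin ≤ ⨆ c, LinearMap.range (hankel1 K N k (q c)).mulVecLin := by
  have h := Hom_iInf_Kr_w_le_iff_iSup_range_le K hk (fun _ : Unit => q₀) q
  simp only [iInf_const, iSup_const] at h
  rwa [inf_eq_right.mpr (Kr_le_Hom K (Finset.univ : Finset (In N)) (w K N N q₀) k)] at h

/-! ## §441. One class each: the kernel determines the column space -/

omit [Fintype ι] [DecidableEq ι] [Fintype ι'] [DecidableEq ι'] in
/-- **`Kr(univ, w_N q′, k) ⊆ Kr(univ, w_N q, k) ↔ col H_k(q) ⊆ col H_k(q′)`** (`k ≤ N`; M14 is `⇐`). -/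
theorem Kr_w_le_Kr_w_iff_range_le {k : ℕ} (hk : k ≤ N) (q q' : ℕ → K) :
    Kr K (Finset.univ : Finset (In N)) (w K N N q') k ≤ Kr K (Finset.univ : Finset (In N)) (w K N N q) k
      ↔ LinearMap.range (hankel1 K N k q).mulVecLin ≤ LinearMap.range (hankel1 K N k q').mulVecLin := by
  have h := Hom_iInf_Kr_w_le_iff_iSup_range_le K hk (fun _ : Unit => q) (fun _ : Unit => q')
  simp only [iInf_const, iSup_const] at h
  rwa [inf_eq_right.mpr (Kr_le_Hom K (Finset.univ : Finset (In N)) (w K N N q') k), inf_eq_right.mpr (Kr_le_Hom K (Finset.univ : Finset (In N)) (w K N N q) k)] at h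

omit [Fintype ι] [DecidableEq ι] [Fintype ι'] [DecidableEq ι'] in
/-- **THE KERNEL DETERMINES THE COLUMN SPACE: `Kr(univ, w_N q, k) = Kr(univ, w_N q′, k) ↔ col H_k(q) = col H_k(q′)`** (`k ≤ N`, every field). -/
theorem Kr_w_eq_Kr_w_iff_range_eq {k : ℕ} (hk : k ≤ N) (q q' : ℕ → K) :
    Kr K (Finset.univ : Finset (In N)) (w K N N q) k = Kr K (Finset.univ : Finset (In N)) (w K N N q') k
      ↔ LinearMap.range (hankel1 K N k q).mulVecLin = LinearMap.range (hankel1 K N k q').mulVecLin := by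
  rw [le_antisymm_iff, le_antisymm_iff, Kr_w_le_Kr_w_iff_range_le K hk q' q, Kr_w_le_Kr_w_iff_range_le K hk q q', and_comm]

omit [Fintype ι] [DecidableEq ι] [Fintype ι'] [DecidableEq ι'] in
/-- strictly: `Kr(univ, w_N q′, k) ⊊ Kr(univ, w_N q, k) ↔ col H_k(q) ⊊ col H_k(q′)` (`k ≤ N`). -/
theorem Kr_w_lt_Kr_w_iff_range_lt {k : ℕ} (hk : k ≤ N) (q q' : ℕ → K) :
    Kr K (Finset.univ : Finset (In N)) (w K N N q') k < Kr K (Finset.univ : Finset (In N)) (w K N N q) k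
      ↔ LinearMap.range (hankel1 K N k q).mulVecLin < LinearMap.range (hankel1 K N k q').mulVecLin := by
  rw [lt_iff_le_not_ge, lt_iff_le_not_ge, Kr_w_le_Kr_w_iff_range_le K hk q q', Kr_w_le_Kr_w_iff_range_le K hk q' q]

/-! ## §442. The images in the mirror degree determine the column spaces too -/

/-- **`⨆_c V(univ, w_N q_c, k′) ⊆ ⨆_{c′} V(univ, w_N q′_{c′}, k′) ↔ Σ_c col H_k(q_c) ⊆ Σ_{c′} col H_k(q′_{c′})`** for `k + k′ = N` (the joint image is the annihilator of the joint
kernel, M11, and the double annihilator, E1). -/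
theorem iSup_V_w_le_iff_iSup_range_le {k k' : ℕ} (hkk' : k + k' = N) (q : ι → ℕ → K) (q' : ι' → ℕ → K) :
    (⨆ c, V K (In N) Finset.univ (w K N N (q c)) k') ≤ (⨆ c, V K (In N) Finset.univ (w K N N (q' c)) k')
      ↔ (⨆ c, LinearMap.range (hankel1 K N k (q c)).mulVecLin) ≤ ⨆ c, LinearMap.range (hankel1 K N k (q' c)).mulVecLin := by
  rw [← Hom_iInf_Kr_w_le_iff_iSup_range_le K (by omega : k ≤ N) q q', iSup_V_w_eq_Ann K hkk' q, iSup_V_w_eq_Ann K hkk' q']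
  constructor
  · intro h
    have h2 := Ann_anti K k h
    rwa [Ann_Ann K (by rw [Fintype.card_fin]; omega) inf_le_left, Ann_Ann K (by rw [Fintype.card_fin]; omega) inf_le_left] at h2
  · exact fun h => Ann_anti K _ h

/-- **THE JOINT IMAGE DETERMINES THE COLUMN SUM** (`k + k′ = N`). -/
theorem iSup_V_w_eq_iff_iSup_range_eq {k k' : ℕ} (hkk' : k + k' = N) (q : ι → ℕ → K) (q' : ι' → ℕ → K) :
    (⨆ c, V K (In N) Finset.univ (w K N N (q c)) k') = (⨆ c, V K (In N) Finset.univ (w K N N (q' c)) k')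
      ↔ (⨆ c, LinearMap.range (hankel1 K N k (q c)).mulVecLin) = ⨆ c, LinearMap.range (hankel1 K N k (q' c)).mulVecLin := by
  rw [le_antisymm_iff, le_antisymm_iff, iSup_V_w_le_iff_iSup_range_le K hkk' q q', iSup_V_w_le_iff_iSup_range_le K hkk' q' q]

omit [Fintype ι] [DecidableEq ι] [Fintype ι'] [DecidableEq ι'] in
/-- one class each: **`V(univ, w_N q, k′) ⊆ V(univ, w_N q′, k′) ↔ col H_k(q) ⊆ col H_k(q′)`** (`k + k′ = N`; M14 is `⇐`). -/
theorem V_w_le_V_w_iff_range_le {k k' : ℕ} (hkk' : k + k' = N) (q q' : ℕ → K) :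
    V K (In N) Finset.univ (w K N N q) k' ≤ V K (In N) Finset.univ (w K N N q') k'
      ↔ LinearMap.range (hankel1 K N k q).mulVecLin ≤ LinearMap.range (hankel1 K N k q').mulVecLin := by
  have h := iSup_V_w_le_iff_iSup_range_le K hkk' (fun _ : Unit => q) (fun _ : Unit => q')
  simp only [iSup_const] at h
  exact h

omit [Fintype ι] [DecidableEq ι] [Fintype ι'] [DecidableEq ι'] in
/-- **THE IMAGE IN THE MIRROR DEGREE DETERMINES THE COLUMN SPACE: `V(univ, w_N q, k′) = V(univ, w_N q′, k′) ↔ col H_k(q) = col H_k(q′)`** (`k + k′ = N`). -/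
theorem V_w_eq_V_w_iff_range_eq {k k' : ℕ} (hkk' : k + k' = N) (q q' : ℕ → K) :
    V K (In N) Finset.univ (w K N N q) k' = V K (In N) Finset.univ (w K N N q') k'
      ↔ LinearMap.range (hankel1 K N k q).mulVecLin = LinearMap.range (hankel1 K N k q').mulVecLin := by
  rw [le_antisymm_iff, le_antisymm_iff, V_w_le_V_w_iff_range_le K hkk' q q', V_w_le_V_w_iff_range_le K hkk' q' q]

end Summit.Ventures.HSemireg.Wedge.HankelOuter
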